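import Summits.Parity.GeneralizedHardyLittlewood.Theorems.BeyondDiagonalBeatsQuarter.OffDiagDualBoxSizeBessel
import HarnessLib

/-!
# Route `PrimeLevelFamEdge`, crux K_B (stmt-Parity-20343), line `diagonal_kernel_split` rev 4, plan Ω,
# worker key L3 (part 6c) `OffDiagDualBoxLedgerScaled`: the per-box trivial ledger in CLOSED FORM after the
# dual truncation `A₁A₂ ≤ Λ·(qr)²(1+Z)²Q²/(K₁K₂)` (L2: `A_j = qr·D_j·Q/(2π)`, `D_j ≍ (1+Z)/K_j`)

With `Z = 4π√(αβK₁K₂)/(qr)`, `W₀ = W(d₁d₂K₁K₂/(4q̂²))`, `g = gcd(α,qr)` and the divisor bound `τ(n) ≤ Cn^δ`,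
L3 part 6b (`sum_dualBox_norm_le_bessel`) reads `Σ_{box} ‖Φ̂_i‖·N ≤ bulk_B·g·(2A₁A₂/(qr)+1)·2C(A₁A₂)^δ`,
`bulk_B = (9/4)K₁K₂(d₁d₂K₁K₂/4)^{−1/2}W₀r⁻¹·140Z(1+Z)^{−3/2}`. Inserting the truncation product (any `Λ, Q ≥ 0`):
* `rpow_box_identity`: `K₁K₂·(d₁d₂K₁K₂/4)^{−1/2}·Z = 8π·√(αβ)·(d₁d₂)^{−1/2}·(K₁K₂)/(qr)` … (the `√K₁K₂` cancels);
* **`sum_dualBox_norm_le_of_truncation`**: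
  `Σ_{box} ‖Φ̂_i(h/(qr))‖·N ≤ 2520π·g·2C(Λ(qr)²(1+Z)²Q²)^δ·W₀·√(αβ)(d₁d₂)^{−1/2}r⁻¹·[2ΛQ²(1+Z)^{1/2} + K₁K₂(1+Z)^{−3/2}/(qr)]`
  — per layer piece this is `≍ √(lm)/(d₁d₂r)·(1+Z)^{1/2}·Q²q^{O(δ)}` (`αβ = lm/(d₁d₂)`), the row whose sum over
  `i ∈ nearBoxes`, `d`, `r ≤ q⁷`, `l, m ≤ q̂^{Δ′}` against `|c_lc_m| ≤ (lm)^{−1/2}` is `q^{(5/4)η+O(ε)}·mainScaleReal`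
  (the `(1+Z)^{1/2} ≲ q̂^{η/2}` at `r = 1` is the `1/4` above `κ₀ = 1`).
Absolute values only; nothing about the heart. Helper (`--supports stmt-Parity-20343`); standard axioms.
«The programme SEARCHES and TYPES; no claim about Landau–Siegel zeros, Theorems 1–2 of arXiv:2211.02515 or
a repaired Margin232 until a kernel theorem says so.»
-/

noncomputable section

open Finset
open scoped Real

namespace Summit.Parity.GeneralizedHardyLittlewood.Theorems.BeyondDiagonalBeatsQuarter.OffDiag

open Literature.NumberTheory.LFunctions Literature.NumberTheory.LFunctions.KMV2000
open Literature.Analysis.FunctionSpaces (besselJ)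
open Literature.NumberTheory.Sieve.FriedlanderIwaniecPrimes (fourier2)

variable {q d₁ d₂ α β r : ℕ}

/-- The `rpow` bookkeeping of the bulk: for `d₁, d₂ ≥ 1`, `K₁, K₂ > 0`,
`K₁K₂·(d₁d₂K₁K₂/4)^{−1/2} = 2·(d₁d₂)^{−1/2}·√(K₁K₂)`. [folklore] -/
theorem bulk_prefactor_eq (hd₁ : 1 ≤ d₁) (hd₂ : 1 ≤ d₂) {K₁ K₂ : ℝ} (hK₁ : 0 < K₁) (hK₂ : 0 < K₂) :
    K₁ * K₂ * ((d₁ : ℝ) * d₂ * (K₁ * K₂) / 4) ^ (-(1 / 2 : ℝ)) =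
      2 * ((d₁ : ℝ) * d₂) ^ (-(1 / 2 : ℝ)) * Real.sqrt (K₁ * K₂) := by
  have hd : (0 : ℝ) < (d₁ : ℝ) * d₂ := by
    have h1 : (0 : ℝ) < d₁ := by exact_mod_cast hd₁
    have h2 : (0 : ℝ) < d₂ := by exact_mod_cast hd₂
    positivity
  have hK : 0 < K₁ * K₂ := mul_pos hK₁ hK₂
  rw [Real.div_rpow (by positivity) (by norm_num), Real.mul_rpow hd.le hK.le,
    show (4 : ℝ) ^ (-(1 / 2 : ℝ)) = 1 / 2 by
      rw [show (4 : ℝ) = 2 ^ (2 : ℝ) by norm_num, ← Real.rpow_mul (by norm_num)]; norm_num,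
    Real.sqrt_eq_rpow]
  have hKK : K₁ * K₂ * (K₁ * K₂) ^ (-(1 / 2 : ℝ)) = (K₁ * K₂) ^ (1 / 2 : ℝ) := by
    rw [show K₁ * K₂ * (K₁ * K₂) ^ (-(1 / 2 : ℝ)) = (K₁ * K₂) ^ (1 : ℝ) * (K₁ * K₂) ^ (-(1 / 2 : ℝ)) by
        rw [Real.rpow_one], ← Real.rpow_add hK]
    norm_num
  calc K₁ * K₂ * (((d₁ : ℝ) * d₂) ^ (-(1 / 2 : ℝ)) * (K₁ * K₂) ^ (-(1 / 2 : ℝ)) / (1 / 2))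
      = 2 * ((d₁ : ℝ) * d₂) ^ (-(1 / 2 : ℝ)) * (K₁ * K₂ * (K₁ * K₂) ^ (-(1 / 2 : ℝ))) := by ring
    _ = _ := by rw [hKK]

/-- `√(αβK₁K₂) = √(αβ)·√(K₁K₂)` and hence `√(K₁K₂)·Z = 4π√(αβ)·(K₁K₂)/(qr)` where
`Z = 4π√(αβK₁K₂)/(qr)`. [folklore] -/
theorem sqrt_mul_Z_eq {K₁ K₂ : ℝ} (hK₁ : 0 < K₁) (hK₂ : 0 < K₂) :
    Real.sqrt (K₁ * K₂) * (4 * π * Real.sqrt ((α : ℝ) * (β : ℝ) * (K₁ * K₂)) / ((q : ℝ) * r)) =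
      4 * π * Real.sqrt ((α : ℝ) * β) * (K₁ * K₂) / ((q : ℝ) * r) := by
  have hK : 0 ≤ K₁ * K₂ := (mul_pos hK₁ hK₂).le
  rw [Real.sqrt_mul (by positivity) (K₁ * K₂)]
  have : Real.sqrt (K₁ * K₂) * Real.sqrt (K₁ * K₂) = K₁ * K₂ := Real.mul_self_sqrt hK
  calc Real.sqrt (K₁ * K₂) * (4 * π * (Real.sqrt ((α : ℝ) * β) * Real.sqrt (K₁ * K₂)) / ((q : ℝ) * r))
      = 4 * π * Real.sqrt ((α : ℝ) * β) * (Real.sqrt (K₁ * K₂) * Real.sqrt (K₁ * K₂)) / ((q : ℝ) * r) := by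
        ring
    _ = _ := by rw [this]

/-- **The per-box trivial ledger after truncation (closed form).** Let `q, d₁, d₂, α, β, r ≥ 1`, `qr ∤ αβ`,
the divisor bound `τ(n) ≤ Cn^δ` (`δ ≥ 0`), `Λ ≥ 0`, any `Q`, and a dual box with
`A₁A₂ ≤ Λ·(qr)²(1+Z)²Q²/(K₁K₂)`, `K_j = 2^{i_j}`, `Z = 4π√(αβK₁K₂)/(qr)`. Then
`Σ_{(h₁,h₂) ∈ [-A₁,A₁]×[-A₂,A₂]} ‖Φ̂_i(h/(qr))‖·N_{qr}(α,β;h)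
   ≤ 2520π · gcd(α,qr) · 2C(Λ(qr)²(1+Z)²Q²)^δ · W(d₁d₂K₁K₂/(4q̂²)) · √(αβ)(d₁d₂)^{−1/2} r⁻¹ ·
     [2ΛQ²(1+Z)^{1/2} + K₁K₂(1+Z)^{−3/2}/(qr)]`.
[cite: KowalskiMichelVanderKam2000, (21)–(23) p. 12 and Lemma 3.3 p. 9 — derivation] -/
theorem sum_dualBox_norm_le_of_truncation [NeZero q] [NeZero (q * r)] (hd₁ : 1 ≤ d₁) (hd₂ : 1 ≤ d₂)
    (hα : 1 ≤ α) (hβ : 1 ≤ β) (hr : 1 ≤ r) (hndvd : ¬ q * r ∣ α * β) (i : ℕ × ℕ) {δ C : ℝ} (hδ : 0 ≤ δ)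
    (hC : ∀ n : ℕ, ((n.divisors.card : ℕ) : ℝ) ≤ C * (n : ℝ) ^ δ) {Λ Q : ℝ} (hΛ : 0 ≤ Λ)
    {A₁ A₂ : ℕ}
    (hA : (A₁ : ℝ) * A₂ ≤ Λ * (((q : ℝ) * r) ^ 2 *
      (1 + 4 * π * Real.sqrt ((α : ℝ) * (β : ℝ) * ((2 : ℝ) ^ i.1 * 2 ^ i.2)) / ((q : ℝ) * r)) ^ 2 * Q ^ 2 /
        ((2 : ℝ) ^ i.1 * 2 ^ i.2))) :
    ∑ h ∈ (Finset.Icc (-(A₁ : ℤ)) A₁) ×ˢ (Finset.Icc (-(A₂ : ℤ)) A₂),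
        ‖fourier2 (boxWeight q d₁ d₂ α β r i) (h.1 / (q * r : ℕ)) (h.2 / (q * r : ℕ))‖ *
          (dualCount (q * r) (α : ZMod (q * r)) (β : ZMod (q * r)) (h.1 : ZMod (q * r)) (h.2 : ZMod (q * r)) : ℝ) ≤
      2520 * π * (Nat.gcd α (q * r) : ℝ) *
        (2 * C * (Λ * (((q : ℝ) * r) ^ 2 *
          (1 + 4 * π * Real.sqrt ((α : ℝ) * (β : ℝ) * ((2 : ℝ) ^ i.1 * 2 ^ i.2)) / ((q : ℝ) * r)) ^ 2 * Q ^ 2)) ^ δ) *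
        cutoffW ((d₁ : ℝ) * d₂ * ((2 : ℝ) ^ i.1 * 2 ^ i.2) / 4 / qhat q ^ 2) *
        (Real.sqrt ((α : ℝ) * β) * ((d₁ : ℝ) * d₂) ^ (-(1 / 2 : ℝ)) * (r : ℝ)⁻¹) *
        (2 * Λ * Q ^ 2 * (1 + 4 * π * Real.sqrt ((α : ℝ) * (β : ℝ) * ((2 : ℝ) ^ i.1 * 2 ^ i.2)) /
            ((q : ℝ) * r)) ^ (1 / 2 : ℝ) +
          (2 : ℝ) ^ i.1 * 2 ^ i.2 * (1 + 4 * π * Real.sqrt ((α : ℝ) * (β : ℝ) * ((2 : ℝ) ^ i.1 * 2 ^ i.2)) /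
            ((q : ℝ) * r)) ^ (-(3 / 2 : ℝ)) / ((q : ℝ) * r)) := by
  -- names
  have hq0 : (0 : ℝ) < q := by exact_mod_cast Nat.pos_of_ne_zero (NeZero.ne q)
  have hr0 : (0 : ℝ) < r := by exact_mod_cast hr
  have hα0 : (0 : ℝ) < α := by exact_mod_cast hα
  have hβ0 : (0 : ℝ) < β := by exact_mod_cast hβ
  have hd₁0 : (0 : ℝ) < d₁ := by exact_mod_cast hd₁
  have hd₂0 : (0 : ℝ) < d₂ := by exact_mod_cast hd₂
  have hC0 : 0 ≤ C := by
    have h := hC 1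
    simp at h
    linarith
  set K : ℝ := (2 : ℝ) ^ i.1 * 2 ^ i.2 with hK
  have hK0 : 0 < K := by positivity
  have hK1 : 1 ≤ K := by
    rw [hK, ← pow_add]; exact one_le_pow₀ (by norm_num)
  set c : ℝ := (q : ℝ) * r with hc
  have hc0 : 0 < c := by positivity
  set Z : ℝ := 4 * π * Real.sqrt ((α : ℝ) * (β : ℝ) * K) / c with hZ
  have hZ0 : 0 < Z := by
    have : 0 < Real.sqrt ((α : ℝ) * (β : ℝ) * K) := Real.sqrt_pos.2 (by positivity)
    positivity
  have h1Z : 0 < 1 + Z := by linarith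
  set W₀ : ℝ := cutoffW ((d₁ : ℝ) * d₂ * K / 4 / qhat q ^ 2) with hW₀
  have hW0 : 0 ≤ W₀ := cutoffW_nonneg _
  set g : ℝ := (Nat.gcd α (q * r) : ℝ) with hg
  have hg0 : 0 ≤ g := Nat.cast_nonneg _
  set P : ℝ := Λ * (c ^ 2 * (1 + Z) ^ 2 * Q ^ 2) with hP
  have hP0 : 0 ≤ P := by positivity
  -- the Bessel-sized per-box ledger
  have hbase := sum_dualBox_norm_le_bessel hd₁ hd₂ hα hβ hr hndvd i hδ hC A₁ A₂
  have hcast : ((q * r : ℕ) : ℝ) = c := by rw [hc]; push_cast; ring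
  rw [hcast] at hbase
  rw [hcast]
  -- truncation: `A₁A₂ ≤ P/K ≤ P`
  have hA' : (A₁ : ℝ) * A₂ ≤ P / K := by rw [hP]; convert hA using 1; rw [hK]; ring
  have hAP : (A₁ : ℝ) * A₂ ≤ P := hA'.trans (div_le_self hP0 hK1)
  have hAδ : ((A₁ : ℝ) * A₂) ^ δ ≤ P ^ δ := Real.rpow_le_rpow (by positivity) hAP hδ
  have hdens : 2 * ((A₁ : ℝ) * A₂) / c + 1 ≤ 2 * (P / K) / c + 1 := by
    have := div_le_div_of_nonneg_right (mul_le_mul_of_nonneg_left hA' (by norm_num : (0 : ℝ) ≤ 2)) hc0.le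
    linarith
  -- the bulk with `J = 140 Z (1+Z)^{-3/2}`
  set B : ℝ := 9 / 4 * K * (((d₁ : ℝ) * d₂ * K / 4) ^ (-(1 / 2 : ℝ)) * W₀ * (r : ℝ)⁻¹ *
    (140 * Z * (1 + Z) ^ (-(3 / 2 : ℝ)))) with hB
  have hB0 : 0 ≤ B := by positivity
  have step1 : B * (g * ((2 * ((A₁ : ℝ) * A₂) / c + 1) * (2 * C * ((A₁ : ℝ) * A₂) ^ δ))) ≤
      B * (g * ((2 * (P / K) / c + 1) * (2 * C * P ^ δ))) := by
    refine mul_le_mul_of_nonneg_left (mul_le_mul_of_nonneg_left ?_ hg0) hB0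
    exact mul_le_mul hdens (mul_le_mul_of_nonneg_left hAδ (by positivity)) (by positivity) (by positivity)
  -- algebra: rewrite the right side in closed form
  have hpre := bulk_prefactor_eq hd₁ hd₂ (K₁ := (2 : ℝ) ^ i.1) (K₂ := (2 : ℝ) ^ i.2) (by positivity)
    (by positivity)
  rw [← hK] at hpre
  have hsZ := sqrt_mul_Z_eq (α := α) (β := β) (q := q) (r := r) (K₁ := (2 : ℝ) ^ i.1) (K₂ := (2 : ℝ) ^ i.2)
    (by positivity) (by positivity)
  rw [← hK, ← hc, ← hZ] at hsZ
  -- `B = (9/4)·2·(d₁d₂)^{-1/2}·√K·W₀·r⁻¹·140·Z·(1+Z)^{-3/2}`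
  have hBeq : B = 630 * ((d₁ : ℝ) * d₂) ^ (-(1 / 2 : ℝ)) * W₀ * (r : ℝ)⁻¹ * (1 + Z) ^ (-(3 / 2 : ℝ)) *
      (Real.sqrt K * Z) := by
    rw [hB, show 9 / 4 * K * (((d₁ : ℝ) * d₂ * K / 4) ^ (-(1 / 2 : ℝ)) * W₀ * (r : ℝ)⁻¹ *
        (140 * Z * (1 + Z) ^ (-(3 / 2 : ℝ)))) =
        9 / 4 * (K * ((d₁ : ℝ) * d₂ * K / 4) ^ (-(1 / 2 : ℝ))) * W₀ * (r : ℝ)⁻¹ *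
          (140 * Z * (1 + Z) ^ (-(3 / 2 : ℝ))) by ring, hpre]
    ring
  rw [hsZ] at hBeq
  -- powers of `(1+Z)`
  have hZ2 : (1 + Z) ^ (-(3 / 2 : ℝ)) * (1 + Z) ^ 2 = (1 + Z) ^ (1 / 2 : ℝ) := by
    rw [← Real.rpow_natCast (1 + Z) 2, ← Real.rpow_add h1Z]; norm_num
  -- main and secondary terms
  have hmain : B * (g * ((2 * (P / K) / c) * (2 * C * P ^ δ))) =
      2520 * π * g * (2 * C * P ^ δ) * W₀ *
        (Real.sqrt ((α : ℝ) * β) * ((d₁ : ℝ) * d₂) ^ (-(1 / 2 : ℝ)) * (r : ℝ)⁻¹) *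
        (2 * Λ * Q ^ 2 * (1 + Z) ^ (1 / 2 : ℝ)) := by
    rw [hBeq, hP]
    field_simp
    rw [← hZ2]
    ring
  have hsec : B * (g * (1 * (2 * C * P ^ δ))) =
      2520 * π * g * (2 * C * P ^ δ) * W₀ *
        (Real.sqrt ((α : ℝ) * β) * ((d₁ : ℝ) * d₂) ^ (-(1 / 2 : ℝ)) * (r : ℝ)⁻¹) *
        (K * (1 + Z) ^ (-(3 / 2 : ℝ)) / c) := by
    rw [hBeq]
    field_simp
    ring
  have hchain : ∑ h ∈ (Finset.Icc (-(A₁ : ℤ)) A₁) ×ˢ (Finset.Icc (-(A₂ : ℤ)) A₂),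
      ‖fourier2 (boxWeight q d₁ d₂ α β r i) (h.1 / c) (h.2 / c)‖ *
        (dualCount (q * r) (α : ZMod (q * r)) (β : ZMod (q * r)) (h.1 : ZMod (q * r)) (h.2 : ZMod (q * r)) : ℝ) ≤
      B * (g * ((2 * (P / K) / c) * (2 * C * P ^ δ))) + B * (g * (1 * (2 * C * P ^ δ))) :=
    calc _ ≤ B * (g * ((2 * ((A₁ : ℝ) * A₂) / c + 1) * (2 * C * ((A₁ : ℝ) * A₂) ^ δ))) := hbase
      _ ≤ B * (g * ((2 * (P / K) / c + 1) * (2 * C * P ^ δ))) := step1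
      _ = B * (g * ((2 * (P / K) / c) * (2 * C * P ^ δ))) + B * (g * (1 * (2 * C * P ^ δ))) := by ring
  rw [hmain, hsec] at hchain
  refine le_of_le_of_eq hchain ?_
  ring

end Summit.Parity.GeneralizedHardyLittlewood.Theorems.BeyondDiagonalBeatsQuarter.OffDiag
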